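import Mathlib.Analysis.SpecificLimits.Basic
import Mathlib.Order.Filter.AtTopBot.Basic
import Mathlib.Topology.MetricSpace.Basic
import HarnessLib

/-!
# Fekete's lemma along squares, with tiling defects and complement filling

Trunk T-QLATTICE (family `hubbard`); the real-analysis step of the thermodynamic limit of the
ground-state energy density of the Hubbard model on two-dimensional tori
(`HubbardTorus2DEnergyDensity.lean`, support item `TwPureThermalBound` of the route
`HubbardSuperconductivity/ThermalWedge`). A sequence `b : ℕ → ℝ` of "energies per site of the
`L × L` box" which is bounded below, tiling-subadditive up to boundary and rounding defects,
`b((k+1)M) ≤ b(M) + C/M + D/M²`, and monotone up to the cost of filling the complement of an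
`ℓ × ℓ` corner of the `L × L` box, `L² b(L) ≤ ℓ² b(ℓ) + C(L² - ℓ² + L)`, converges — to
`inf_M (b M + C/M + D/M²)` (`tendsto_of_tiling_of_filling`). This is Fekete's lemma in the shape
produced by cutting tori (Ruelle, *Statistical Mechanics* (1969), §2.1–2.2; compare
`Summit…Theorems.stub_subadditiveLimit2D` of the route `WeakCouplingBCS`, which assumes an exact
monotonicity `a(L) ≤ a(M) + CL` instead of the complement filling). Everything is proved; no
definition. [folklore]
-/

open Filter Topology

namespace Literature.MathematicalPhysics.QuantumLattice.ThermodynamicLimit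

/-- **Fekete's lemma along squares, with tiling defects and complement filling.** Let
`b : ℕ → ℝ` (think: an energy per site of the `L × L` torus) satisfy, for `M ≥ M₀ ≥ 1`,
(i) `b M ≥ -c`; (ii) tiling: `b((k+1)M) ≤ b(M) + C/M + D/M²`; (iii) filling: for `M₀ ≤ ℓ ≤ L`,
`L² b(L) ≤ ℓ² b(ℓ) + C(L² - ℓ² + L)`, with `C, D ≥ 0`. Then `b(L)` converges (to
`inf_{M ≥ M₀} (b M + C/M + D/M²)`). (Ruelle, *Statistical Mechanics* (1969), §2.1–2.2.) [folklore] -/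
theorem tendsto_of_tiling_of_filling (b : ℕ → ℝ) {C D c : ℝ} {M₀ : ℕ} (hM₀ : 1 ≤ M₀) (hC : 0 ≤ C)
    (hD : 0 ≤ D) (hlow : ∀ M, M₀ ≤ M → -c ≤ b M)
    (htile : ∀ k M : ℕ, M₀ ≤ M → b ((k + 1) * M) ≤ b M + C / M + D / (M : ℝ) ^ 2)
    (hfill : ∀ ℓ L : ℕ, M₀ ≤ ℓ → ℓ ≤ L →
      (L : ℝ) ^ 2 * b L ≤ (ℓ : ℝ) ^ 2 * b ℓ + C * ((L : ℝ) ^ 2 - (ℓ : ℝ) ^ 2 + L)) :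
    ∃ e : ℝ, Tendsto b atTop (𝓝 e) := by
  -- the candidate limit
  set B : ℕ → ℝ := fun M => b M + C / M + D / (M : ℝ) ^ 2 with hB
  set S : Set ℝ := B '' {M | M₀ ≤ M} with hS
  have hSne : S.Nonempty := ⟨B M₀, M₀, Set.mem_setOf.2 le_rfl, rfl⟩
  have hSbdd : BddBelow S := by
    refine ⟨-c, ?_⟩
    rintro _ ⟨M, hM, rfl⟩
    have h1 := hlow M hM
    have h2 : 0 ≤ C / M := by positivity
    have h3 : 0 ≤ D / (M : ℝ) ^ 2 := by positivity
    simp only [hB]; linarith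
  set β := sInf S with hβ
  have hβle : ∀ M, M₀ ≤ M → β ≤ B M := fun M hM => csInf_le hSbdd ⟨M, hM, rfl⟩
  refine ⟨β, Metric.tendsto_atTop.2 fun ε hε => ?_⟩
  -- choose `M` with `B M < β + ε/2`
  obtain ⟨_, ⟨M, hM, rfl⟩, hBM⟩ := exists_lt_of_csInf_lt hSne (lt_add_of_pos_right β (half_pos hε))
  have hM1 : 1 ≤ M := hM₀.trans hM
  have hMpos : (0 : ℝ) < M := by exact_mod_cast hM1
  -- the error term `(2M|B M| + C(2M+1))/L` and the lower error `C/L + D/L²`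
  set R : ℝ := 2 * M * |B M| + C * (2 * M + 1) with hR
  have hR0 : 0 ≤ R := by positivity
  obtain ⟨L₁, hL₁⟩ := exists_nat_gt (max (R / (ε / 2)) ((C + D) / (ε / 2)))
  refine ⟨max L₁ (max M 1), fun L hL => ?_⟩
  have hLL₁ : L₁ ≤ L := le_of_max_le_left hL
  have hLM : M ≤ L := le_of_max_le_left (le_of_max_le_right hL)
  have hL1 : 1 ≤ L := le_of_max_le_right (le_of_max_le_right hL)
  have hLpos : (0 : ℝ) < L := by exact_mod_cast hL1
  have hLgt : max (R / (ε / 2)) ((C + D) / (ε / 2)) < L := hL₁.trans_le (by exact_mod_cast hLL₁)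
  have hRL : R / L < ε / 2 := by
    rw [div_lt_iff₀ hLpos]
    have := (le_max_left _ _).trans_lt hLgt
    rw [div_lt_iff₀ (half_pos hε)] at this
    linarith
  have hCDL : (C + D) / L < ε / 2 := by
    rw [div_lt_iff₀ hLpos]
    have := (le_max_right _ _).trans_lt hLgt
    rw [div_lt_iff₀ (half_pos hε)] at this
    linarith
  rw [Real.dist_eq, abs_sub_lt_iff]
  constructor
  · -- upper bound: `b L ≤ B M + R / L`
    set k : ℕ := L / M with hk
    have hk1 : 1 ≤ k := (Nat.one_le_div_iff (hM₀.trans hM)).2 hLM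
    set ℓ : ℕ := k * M with hℓ
    have hℓL : ℓ ≤ L := Nat.div_mul_le_self L M
    have hℓM : M ≤ ℓ := by
      calc M = 1 * M := (one_mul M).symm
        _ ≤ k * M := Nat.mul_le_mul_right M hk1
    have hM₀ℓ : M₀ ≤ ℓ := hM.trans hℓM
    have hLℓ : L - ℓ < M := by
      have := Nat.div_add_mod' L M
      have h2 : L % M < M := Nat.mod_lt L (hM₀.trans hM)
      rw [hℓ, hk]
      omega
    -- tiling at `ℓ = k M`
    have ht : b ℓ ≤ B M := by
      obtain ⟨k', hk'⟩ : ∃ k', k = k' + 1 := ⟨k - 1, by omega⟩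
      rw [hℓ, hk']
      exact htile k' M hM
    -- filling from `ℓ` to `L`
    have hf := hfill ℓ L hM₀ℓ hℓL
    have hℓpos : (0 : ℝ) ≤ ℓ := by positivity
    have hℓL' : (ℓ : ℝ) ≤ L := by exact_mod_cast hℓL
    have hgap : (L : ℝ) ^ 2 - (ℓ : ℝ) ^ 2 ≤ 2 * L * M := by
      have h1 : (L : ℝ) - ℓ ≤ M := by
        have : ((L - ℓ : ℕ) : ℝ) < M := by exact_mod_cast hLℓ
        rw [Nat.cast_sub hℓL] at this
        exact this.le
      nlinarith
    -- `ℓ² b ℓ ≤ ℓ² B M ≤ L² B M + (L² - ℓ²)|B M|`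
    have h1 : (ℓ : ℝ) ^ 2 * b ℓ ≤ (L : ℝ) ^ 2 * B M + ((L : ℝ) ^ 2 - (ℓ : ℝ) ^ 2) * |B M| := by
      have h2 : (ℓ : ℝ) ^ 2 * b ℓ ≤ (ℓ : ℝ) ^ 2 * B M := mul_le_mul_of_nonneg_left ht (by positivity)
      have h3 : (ℓ : ℝ) ^ 2 * B M = (L : ℝ) ^ 2 * B M - ((L : ℝ) ^ 2 - (ℓ : ℝ) ^ 2) * B M := by ring
      have h4 : -(((L : ℝ) ^ 2 - (ℓ : ℝ) ^ 2) * B M) ≤ ((L : ℝ) ^ 2 - (ℓ : ℝ) ^ 2) * |B M| := by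
        rw [← mul_neg]
        exact mul_le_mul_of_nonneg_left (neg_le_abs _) (by nlinarith)
      linarith
    have h5 : (L : ℝ) ^ 2 * b L ≤ (L : ℝ) ^ 2 * B M + L * R := by
      have h6 : ((L : ℝ) ^ 2 - (ℓ : ℝ) ^ 2) * |B M| ≤ 2 * L * M * |B M| :=
        mul_le_mul_of_nonneg_right hgap (abs_nonneg _)
      have h7 : C * ((L : ℝ) ^ 2 - (ℓ : ℝ) ^ 2 + L) ≤ C * (2 * L * M + L) := by
        exact mul_le_mul_of_nonneg_left (by linarith) hC
      have : L * R = 2 * L * M * |B M| + C * (2 * L * M + L) := by simp only [hR]; ring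
      linarith
    have h8 : b L ≤ B M + R / L := by
      have hL2 : (0 : ℝ) < (L : ℝ) ^ 2 := by positivity
      have key : (L : ℝ) ^ 2 * b L ≤ (L : ℝ) ^ 2 * (B M + R / L) := by
        have : (L : ℝ) ^ 2 * (B M + R / L) = (L : ℝ) ^ 2 * B M + L * R := by
          field_simp
        rw [this]; exact h5
      exact le_of_mul_le_mul_left key hL2
    linarith
  · -- lower bound: `β ≤ B L = b L + C/L + D/L²`
    have h1 := hβle L (hM.trans hLM)
    have h2 : C / L + D / (L : ℝ) ^ 2 ≤ (C + D) / L := by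
      rw [add_div]
      have hL1' : (1 : ℝ) ≤ L := by exact_mod_cast hL1
      have hLL : (L : ℝ) ≤ (L : ℝ) ^ 2 := by nlinarith
      have : D / (L : ℝ) ^ 2 ≤ D / L := div_le_div_of_nonneg_left hD hLpos hLL
      linarith
    simp only [hB] at h1
    linarith

end Literature.MathematicalPhysics.QuantumLattice.ThermodynamicLimit
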